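import Literature.MathematicalPhysics.QuantumLattice.PeierlsChessboardTorusXYZ
import Literature.MathematicalPhysics.QuantumLattice.ConstrainedBoltzmannWeightBound
import HarnessLib

/-!
# Long-range order of the Ising-type models `-Σ S³S³` (every spin) at low temperature via the
# volume-uniform Peierls–chessboard bound — an unconditional end-to-end instance

Topic `MathematicalPhysics/QuantumLattice`. Fröhlich–Lieb's Peierls–chessboard method is written
in §I.B–E of their paper for general single-site projections `P±` and reduces, for the Ising model
("(i) The Ising model has … long range order for large `β`; for all values `S = 1/2, 1, …` of the
spin", their §I), to the Peierls argument. This file runs the tree's typed version of the method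
(`PeierlsChessboardTorusBound`, `PeierlsChessboardTorusLongRangeOrder`, the XYZ packaging
`PeierlsChessboardTorusXYZ` and the constrained Boltzmann weight `ConstrainedBoltzmannWeightBound`)
END TO END, with no hypothesis left open, for the diagonal member `J₁ = J₂ = 0`, `h = 0` of the
Björnberg–Ueltschi family, `H = xyzRealFieldHamiltonian L n 0 0 0 = -Σ_{⟨xy⟩} S³_x S³_y` (spin
`n/2`) on the 2-torus `(ℤ/Nbℤ)²`, with FL's projections (1.12) `P⁺ = 𝟙[S³ ≥ 0]`, `P⁻ = 𝟙[S³ < 0]`: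

* `xyzRealFieldHamiltonian_zero_eq_diagonal` — `H` is the diagonal matrix of the Ising-type
  energy `isingTypeEnergy σ = -Σ_{⟨xy⟩} s(σ_x)s(σ_y)`, `s(k) = n/2 - k`;
* `szNonnegProj`, `szNegProj` (+ positivity, `P⁺ + P⁻ = 1`, reality, `P⁺ - P⁻ = 2S³` for spin ½);
* **`isingType_dipole_le`** — THE SMALLNESS DATUM (FL (1.45)–(1.47), §III (3.4)–(3.7) in the
  classical case): for every shift `v` and every nearest-neighbour dipole `⟨i, j⟩` inside one cube
  of side `b`, the universal projection `P_Λ` (the dipole tiled over all `N²` cubes with mirror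
  images) satisfies `Re⟨P_Λ⟩_β ≤ κ^{N²}`, `κ = (n+1)^{b²} e^{-βn²/4}`: every configuration in the
  range of `P_Λ` has a broken bond in every cube (energy `≥ E₀ + N²n²/4`), and
  `tr P_Λ ≤ (n+1)^{(Nb)²}`;
* **`isingType_twoPoint_le`**, **`isingType_sigma_twoPoint_ge_half`** — hence, for `N` even,
  `N > 1`, `Nb > 2`, `β ≥ 0` with `κ ≤ 1`: `Re⟨Pₘ⁺Pₙ⁻⟩_β ≤ 4ρ/(1-ρ)²`
  (`ρ = 4·19⁶·κ^{(b-1)/b⁵} < 1`) and `Re⟨σₘσₙ⟩_β ≥ 1/2` once `κ^{(b-1)/b⁵} ≤ 10⁻¹⁰`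
  (`σ = P⁺ - P⁻ = sgn S³`), for ALL `m ≠ n`, uniformly in the volume;
* **`isingHalf_sigma_twoPoint_ge_half`**, **`isingHalf_szsz_ge`** — the quotable spin-½ instance
  (`b = 2`): for every even `N > 1`, every `β ≥ 3000` and all sites `m ≠ n` of `(ℤ/2Nℤ)²`,
  `⟨(2S³ₘ)(2S³ₙ)⟩_β ≥ 1/2`, i.e. `⟨S³ₘS³ₙ⟩_β ≥ 1/8` — FL's long-range order (1.9) with `M² = 1/2`,
  by reflection positivity + chessboard + Peierls, with honest (poor) constants.

No named facts; no sorries.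

## References

* J. Fröhlich, E. H. Lieb, *Phase transitions in anisotropic lattice spin systems*, Comm. Math.
  Phys. **60** (1978) 233–267, §I (i), eqs. (1.9)–(1.12), Thm. 1.1, Cor. 1.2, eqs. (1.44)–(1.47),
  §III eqs. (3.4)–(3.7). [FrohlichLieb1978]
* R. Peierls, *On Ising's model of ferromagnetism*, Proc. Cambridge Philos. Soc. **32** (1936)
  477–481. [Peierls1936]
* J. E. Björnberg, D. Ueltschi, *Reflection positivity and infrared bounds for quantum spin
  systems* (2022), eq. (5.15). [BjornbergUeltschi2022]
-/

noncomputable section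

open Matrix Finset NormedSpace
open scoped Kronecker ComplexOrder MatrixOrder BigOperators
open Literature.MathematicalPhysics.QuantumLattice Literature.Probability.LatticeModels
  Literature.Barriers.CriticalPhenomena.NonGibbs

namespace Literature.MathematicalPhysics.QuantumLattice

/-! ### Diagonal single-site and product operators -/

section Diagonal

variable {Λ : Type*} [Fintype Λ] [DecidableEq Λ] {q : ℕ}

/-- A diagonal single-site matrix placed at `x` is diagonal. [folklore] -/
private theorem pcti_onSite_diagonal (x : Λ) (w : Fin q → ℂ) :
    onSite x (diagonal w) = diagonal fun σ : TensorIndex Λ q => w (σ x) := by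
  ext σ τ
  simp only [onSite, of_apply, diagonal_apply]
  by_cases h : σ = τ
  · subst h
    rw [if_pos fun _ _ => rfl, if_pos rfl, if_pos rfl]
  · rw [if_neg h]
    by_cases h1 : ∀ y, y ≠ x → σ y = τ y
    · rw [if_pos h1, if_neg]
      intro h2
      exact h (funext fun y => if hy : y = x then hy ▸ h2 else h1 y hy)
    · rw [if_neg h1]

omit [DecidableEq Λ] in
/-- A product of diagonal single-site matrices is diagonal:
`⨂_x diag(w_x) = diag(σ ↦ ∏_x w_x(σ_x))`. [folklore] -/
private theorem pcti_productOp_diagonal (w : Λ → Fin q → ℂ) :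
    productOp (fun x => diagonal (w x)) = diagonal fun σ : TensorIndex Λ q => ∏ x, w x (σ x) := by
  ext σ τ
  rw [productOp_apply, diagonal_apply]
  by_cases h : σ = τ
  · subst h
    rw [if_pos rfl]
    exact prod_congr rfl fun x _ => diagonal_apply_eq _ _
  · rw [if_neg h]
    obtain ⟨x, hx⟩ := Function.ne_iff.1 h
    exact prod_eq_zero (mem_univ x) (diagonal_apply_ne _ hx)

end Diagonal

/-! ### The Ising-type energy and the diagonal form of `-Σ S³S³` -/

section IsingType

variable {Λ : Type*} [Fintype Λ] [DecidableEq Λ] (n : ℕ)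

/-- The eigenvalue `s(k) = n/2 - k` of `S³` (spin `n/2`) on the basis state `k ∈ {0,…,n}`.
[cite: FrohlichLieb1978, §I.B eq. (1.12)] -/
def szVal (k : Fin (n + 1)) : ℝ := (n : ℝ) / 2 - (k : ℕ)

/-- `|s(k)| ≤ n/2`. [cite: FrohlichLieb1978, §I.B] -/
theorem abs_szVal_le (k : Fin (n + 1)) : |szVal n k| ≤ (n : ℝ) / 2 := by
  have hk : ((k : ℕ) : ℝ) ≤ n := by exact_mod_cast Nat.lt_succ_iff.1 k.isLt
  have hk0 : (0 : ℝ) ≤ ((k : ℕ) : ℝ) := Nat.cast_nonneg _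
  rw [szVal, abs_le]
  constructor <;> linarith

/-- `S³_x = diag(σ ↦ s(σ_x))`. [cite: FrohlichLieb1978, §I.B] -/
private theorem pcti_siteSpin_two (x : Λ) :
    siteSpin n x 2 = diagonal fun σ : TensorIndex Λ (n + 1) => ((szVal n (σ x) : ℝ) : ℂ) := by
  rw [siteSpin, spinVec_two, SpinOperators.spinZ, pcti_onSite_diagonal]
  congr 1
  funext σ
  simp only [szVal]
  push_cast
  rfl

/-- `S³_x S³_y` (symmetrised) `= diag(σ ↦ s(σ_x)s(σ_y))`. [cite: FrohlichLieb1978, §I.B] -/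
private theorem pcti_spinBond_two (x y : Λ) :
    spinBond n 2 x y =
      diagonal fun σ : TensorIndex Λ (n + 1) => ((szVal n (σ x) * szVal n (σ y) : ℝ) : ℂ) := by
  rw [spinBond, pcti_siteSpin_two, pcti_siteSpin_two, diagonal_mul_diagonal, diagonal_mul_diagonal,
    diagonal_add, ← diagonal_smul]
  congr 1
  funext σ
  simp only [Pi.smul_apply, smul_eq_mul]
  push_cast
  ring

/-- The diagonal bond of the family at `J₁ = J₂ = 0`, `h = 0`: `-S³_xS³_y = diag(-s(σ_x)s(σ_y))`.
[cite: BjornbergUeltschi2022, eq. (5.15)] -/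
private theorem pcti_xyzRealBond_zero (x y : Λ) :
    xyzRealBond n 0 0 0 x y =
      diagonal fun σ : TensorIndex Λ (n + 1) => ((-(szVal n (σ x) * szVal n (σ y)) : ℝ) : ℂ) := by
  have h0 : xyzRealBond n 0 0 0 x y = -spinBond n 2 x y := by
    simp only [xyzRealBond, Complex.ofReal_zero, zero_smul, neg_zero, zero_sub, Pi.zero_apply,
      sub_self, sub_zero, ne_eq, OfNat.ofNat_ne_zero, not_false_eq_true, zero_pow,
      zero_div, add_zero]
  rw [h0, pcti_spinBond_two, diagonal_neg]
  congr 1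
  funext σ
  push_cast
  ring

variable {d : ℕ} (L : ℕ) [NeZero L]

/-- **The Ising-type energy** of a classical configuration `σ : (ℤ/Lℤ)^d → {0,…,n}`:
`E(σ) = -Σ_{⟨xy⟩} s(σ_x) s(σ_y)`, `s(k) = n/2 - k` (nearest-neighbour bonds of the torus, each
once). [cite: FrohlichLieb1978, §I (i), §I.B] -/
def isingTypeEnergy (σ : TensorIndex (TorusSite d L) (n + 1)) : ℝ :=
  ∑ e ∈ (torusGraph d L).edgeFinset,
    Sym2.lift ⟨fun x y => -(szVal n (σ x) * szVal n (σ y)), fun _ _ => by ring⟩ e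

/-- **`-Σ S³S³` is the diagonal matrix of the Ising-type energy**:
`xyzRealFieldHamiltonian L n 0 0 0 = diag(σ ↦ E(σ))`. [cite: FrohlichLieb1978, §I (i), §I.B]
[cite: BjornbergUeltschi2022, eq. (5.15)] -/
theorem xyzRealFieldHamiltonian_zero_eq_diagonal :
    xyzRealFieldHamiltonian L n 0 0 0 =
      diagonal fun σ : TensorIndex (TorusSite d L) (n + 1) => ((isingTypeEnergy n L σ : ℝ) : ℂ) := by
  unfold xyzRealFieldHamiltonian isingTypeEnergy
  calc ∑ e ∈ (torusGraph d L).edgeFinset, Sym2.lift ⟨fun x y => xyzRealBond n 0 0 0 x y,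
          fun _ _ => xyzRealBond_comm n 0 0 0 _ _⟩ e
      = ∑ e ∈ (torusGraph d L).edgeFinset, diagonal fun σ : TensorIndex (TorusSite d L) (n + 1) =>
          ((Sym2.lift ⟨fun x y => -(szVal n (σ x) * szVal n (σ y)), fun _ _ => by ring⟩ e : ℝ) :
            ℂ) := by
        refine sum_congr rfl fun e _ => Sym2.inductionOn e fun x y => ?_
        simp only [Sym2.lift_mk]
        exact pcti_xyzRealBond_zero n x y
    _ = _ := by
        ext σ τ
        rw [Matrix.sum_apply, diagonal_apply]
        simp only [diagonal_apply]
        split_ifs with h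
        · rw [Complex.ofReal_sum]
        · exact sum_const_zero

/-- The energy of the fully aligned configuration `σ ≡ 0` (`S³ = n/2` everywhere):
`E₀ = -(n²/4)·#bonds`. [cite: FrohlichLieb1978, §I.B] -/
theorem isingTypeEnergy_zero :
    isingTypeEnergy n L (fun _ : TorusSite d L => (0 : Fin (n + 1))) =
      -((n : ℝ) ^ 2 / 4) * (torusGraph d L).edgeFinset.card := by
  rw [isingTypeEnergy, show -((n : ℝ) ^ 2 / 4) * ((torusGraph d L).edgeFinset.card : ℝ) =
    ∑ _e ∈ (torusGraph d L).edgeFinset, -((n : ℝ) ^ 2 / 4) by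
      rw [sum_const, nsmul_eq_mul, mul_comm]]
  refine sum_congr rfl fun e _ => Sym2.inductionOn e fun x y => ?_
  simp only [Sym2.lift_mk, szVal, Fin.val_zero, Nat.cast_zero, sub_zero]
  ring

omit [NeZero L] in
/-- Every bond energy is `≥ -n²/4`. [cite: FrohlichLieb1978, §I.B] -/
theorem neg_le_isingTypeBond (σ : TensorIndex (TorusSite d L) (n + 1)) (e : Sym2 (TorusSite d L)) :
    -((n : ℝ) ^ 2 / 4) ≤
      Sym2.lift ⟨fun x y => -(szVal n (σ x) * szVal n (σ y)), fun _ _ => by ring⟩ e := by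
  induction e using Sym2.ind with
  | h x y =>
    rw [Sym2.lift_mk, neg_le_neg_iff]
    calc szVal n (σ x) * szVal n (σ y) ≤ |szVal n (σ x)| * |szVal n (σ y)| := by
          rw [← abs_mul]; exact le_abs_self _
      _ ≤ (n : ℝ) / 2 * ((n : ℝ) / 2) :=
          mul_le_mul (abs_szVal_le n _) (abs_szVal_le n _) (abs_nonneg _) (by positivity)
      _ = (n : ℝ) ^ 2 / 4 := by ring

end IsingType

/-! ### Fröhlich–Lieb's projections `P⁺ = 𝟙[S³ ≥ 0]`, `P⁻ = 𝟙[S³ < 0]` -/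

section Projections

variable (n : ℕ)

/-- **`P⁺ = 𝟙[S³ ≥ 0]`** (FL (1.12), `P⁺_j = 1 - P_j(0)`): the diagonal projection onto the basis
states `k` with `s(k) = n/2 - k ≥ 0`, i.e. `2k ≤ n`. [cite: FrohlichLieb1978, eq. (1.12)] -/
def szNonnegProj : Matrix (Fin (n + 1)) (Fin (n + 1)) ℂ :=
  diagonal fun k => if 2 * (k : ℕ) ≤ n then 1 else 0

/-- **`P⁻ = 𝟙[S³ < 0]`** (FL (1.12), `P⁻_j = P_j(0)`): the diagonal projection onto the basis
states `k` with `2k > n`. [cite: FrohlichLieb1978, eq. (1.12)] -/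
def szNegProj : Matrix (Fin (n + 1)) (Fin (n + 1)) ℂ :=
  diagonal fun k => if 2 * (k : ℕ) ≤ n then 0 else 1

/-- The weight vector of `P⁺`. [cite: FrohlichLieb1978, eq. (1.12)] -/
private def pcti_up (n : ℕ) : Fin (n + 1) → ℂ := fun k => if 2 * (k : ℕ) ≤ n then 1 else 0

/-- The weight vector of `P⁻`. [cite: FrohlichLieb1978, eq. (1.12)] -/
private def pcti_dn (n : ℕ) : Fin (n + 1) → ℂ := fun k => if 2 * (k : ℕ) ≤ n then 0 else 1

/-- `P⁺ = diag(up)`. [cite: FrohlichLieb1978, eq. (1.12)] -/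
private theorem pcti_szNonnegProj_eq : szNonnegProj n = diagonal (pcti_up n) := rfl

/-- `P⁻ = diag(dn)`. [cite: FrohlichLieb1978, eq. (1.12)] -/
private theorem pcti_szNegProj_eq : szNegProj n = diagonal (pcti_dn n) := rfl

/-- The weights of `P⁺` are `0` or `1`. [cite: FrohlichLieb1978, eq. (1.12)] -/
private theorem pcti_up01 (k : Fin (n + 1)) : pcti_up n k = 0 ∨ pcti_up n k = 1 := by
  unfold pcti_up
  split_ifs <;> simp

/-- The weights of `P⁻` are `0` or `1`. [cite: FrohlichLieb1978, eq. (1.12)] -/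
private theorem pcti_dn01 (k : Fin (n + 1)) : pcti_dn n k = 0 ∨ pcti_dn n k = 1 := by
  unfold pcti_dn
  split_ifs <;> simp

/-- `P⁺ ≥ 0`. [cite: FrohlichLieb1978, eq. (1.12)] -/
theorem szNonnegProj_posSemidef : (szNonnegProj n).PosSemidef :=
  posSemidef_diagonal_iff.2 fun k => by by_cases h : 2 * (k : ℕ) ≤ n <;> simp [h]

/-- `P⁻ ≥ 0`. [cite: FrohlichLieb1978, eq. (1.12)] -/
theorem szNegProj_posSemidef : (szNegProj n).PosSemidef :=
  posSemidef_diagonal_iff.2 fun k => by by_cases h : 2 * (k : ℕ) ≤ n <;> simp [h]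

/-- `P⁺ + P⁻ = 1`. [cite: FrohlichLieb1978, eqs. (1.10), (1.12)] -/
theorem szNonnegProj_add_szNegProj : szNonnegProj n + szNegProj n = 1 := by
  rw [szNonnegProj, szNegProj, diagonal_add, ← diagonal_one]
  congr 1
  funext k
  split_ifs <;> simp

/-- `P⁺` is real. [cite: FrohlichLieb1978, eq. (1.12)] -/
theorem szNonnegProj_map_starRingEnd : (szNonnegProj n).map (starRingEnd ℂ) = szNonnegProj n := by
  rw [szNonnegProj, diagonal_map (map_zero _)]
  congr 1
  funext k
  split_ifs <;> simp

/-- `P⁻` is real. [cite: FrohlichLieb1978, eq. (1.12)] -/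
theorem szNegProj_map_starRingEnd : (szNegProj n).map (starRingEnd ℂ) = szNegProj n := by
  rw [szNegProj, diagonal_map (map_zero _)]
  congr 1
  funext k
  split_ifs <;> simp

/-- For spin ½ the order observable `σ = P⁺ - P⁻` is `2S³ = σᶻ` (FL: `m_i = S⁻¹S^z_i`).
[cite: FrohlichLieb1978, eqs. (1.9), (1.12)] -/
theorem szNonnegProj_sub_szNegProj_one :
    szNonnegProj 1 - szNegProj 1 = (2 : ℂ) • SpinOperators.spinZ 1 := by
  ext k l
  fin_cases k <;> fin_cases l <;>
    norm_num [szNonnegProj, szNegProj, SpinOperators.spinZ, diagonal_apply]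

end Projections

/-! ### The universal dipole projection has a broken bond in every cube -/

section Dipole

variable {d : ℕ} {N b : ℕ} [NeZero N] [NeZero b]

/-- The site of the cube `c'` at which the universal projection built from the cube `c` reads the
offset `o` of `c`: `b c' + θ_{c'}(θ_c(o))` (`θ` the parity mirror). [cite: FrohlichLieb1978, eq. (1.35)] -/
private def pcti_img (hN : Even N) (c c' : BlockIdx d N) (o : Fin d → Fin b) : TorusSite d (N * b) :=
  blockSite N b (c', cubeUnmirror hN c' (cubeUnmirror hN c o))

/-- The image site lies in the cube `c'`. [cite: FrohlichLieb1978, eq. (1.35)] -/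
private theorem pcti_blockOf_img (hN : Even N) (c c' : BlockIdx d N) (o : Fin d → Fin b) :
    blockOf N b (pcti_img hN c c' o) = c' := by
  rw [pcti_img, blockOf_blockSite]

/-- The universal pattern of the cube of `x - v` reads the site `x` at the image of `x` in every
cube: `b·blockOf(x-v) + θ(mirroredOffset(img)) + v = x`. [cite: FrohlichLieb1978, eqs. (1.35)–(1.36)] -/
private theorem pcti_phi_img (hN : Even N) (v x : TorusSite d (N * b)) (c' : BlockIdx d N) :
    blockSite N b (blockOf N b (x - v), cubeUnmirror hN (blockOf N b (x - v))
        (mirroredOffset hN (pcti_img hN (blockOf N b (x - v)) c' (offsetOf N b (x - v))))) + v =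
      x := by
  simp only [pcti_img, mirroredOffset_eq_cubeUnmirror, blockOf_blockSite, offsetOf_blockSite,
    cubeUnmirror_cubeUnmirror, blockSite_blockOf_offsetOf, sub_add_cancel]

/-- Inside one cube, a unit step in direction `k` raises the `k`-th offset by one and keeps the
others. [cite: FriedliVelenik2017, §10.2] -/
private theorem pcti_offsetOf_add_single [NeZero (N * b)] (hN1 : 1 < N) {x : TorusSite d (N * b)}
    {k : Fin d} (hblk : blockOf N b (x + Pi.single k 1) = blockOf N b x) :
    (∀ l, l ≠ k → offsetOf N b (x + Pi.single k 1) l = offsetOf N b x l) ∧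
      ((offsetOf N b (x + Pi.single k 1) k : ℕ) = (offsetOf N b x k : ℕ) + 1) := by
  have hb : 0 < b := Nat.pos_of_ne_zero (NeZero.ne b)
  have hval : ∀ (y : TorusSite d (N * b)) (l : Fin d),
      (y l).val = b * (blockOf N b y l).val + (offsetOf N b y l : ℕ) := fun y l => by
    conv_lhs => rw [← blockSite_blockOf_offsetOf N b y]
    exact val_blockSite N b _ l
  refine ⟨fun l hl => ?_, ?_⟩
  · have h1 := hval (x + Pi.single k 1) l
    rw [hblk, Pi.add_apply, Pi.single_eq_of_ne hl, add_zero, hval x l] at h1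
    exact Fin.ext (by omega)
  · have h1 := hval (x + Pi.single k 1) k
    rw [hblk, Pi.add_apply, Pi.single_eq_same] at h1
    have h0 := hval x k
    have hxlt : (x k).val < N * b := ZMod.val_lt _
    have ho : (offsetOf N b x k : ℕ) < b := (offsetOf N b x k).isLt
    have hNb : 2 * b ≤ N * b := Nat.mul_le_mul_right _ hN1
    have hone : (1 : ZMod (N * b)).val = 1 := by
      rw [ZMod.val_one_eq_one_mod, Nat.mod_eq_of_lt (by omega)]
    rw [ZMod.val_add, hone, h0] at h1
    by_cases hA : b * (blockOf N b x k).val + (offsetOf N b x k : ℕ) + 1 < N * b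
    · rw [Nat.mod_eq_of_lt hA] at h1
      omega
    · have heq : b * (blockOf N b x k).val + (offsetOf N b x k : ℕ) + 1 = N * b := by omega
      rw [heq, Nat.mod_self] at h1
      have hc0 : b * (blockOf N b x k).val = 0 := by omega
      rcases Nat.eq_zero_or_pos (blockOf N b x k).val with hc | hc
      · rw [hc, mul_zero, zero_add] at heq
        omega
      · have : b * 1 ≤ b * (blockOf N b x k).val := Nat.mul_le_mul_left _ hc
        omega

omit [NeZero N] [NeZero b] in
/-- The double mirror `θ_{c'} ∘ θ_c` acts coordinatewise by the identity or the reversal, so it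
maps a unit step in direction `k` to a unit step in direction `k` (up to orientation).
[cite: FrohlichLieb1978, eq. (1.35)] -/
private theorem pcti_unmirror_step (hN : Even N) (c c' : BlockIdx d N) {o o' : Fin d → Fin b}
    {k : Fin d} (hl : ∀ l, l ≠ k → o' l = o l) (hk : (o' k : ℕ) = (o k : ℕ) + 1) :
    (∀ l, l ≠ k →
      cubeUnmirror hN c' (cubeUnmirror hN c o') l = cubeUnmirror hN c' (cubeUnmirror hN c o) l) ∧
    (((cubeUnmirror hN c' (cubeUnmirror hN c o') k : ℕ) =
        (cubeUnmirror hN c' (cubeUnmirror hN c o) k : ℕ) + 1) ∨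
      ((cubeUnmirror hN c' (cubeUnmirror hN c o) k : ℕ) =
        (cubeUnmirror hN c' (cubeUnmirror hN c o') k : ℕ) + 1)) := by
  refine ⟨fun l hl' => by simp only [cubeUnmirror, hl l hl'], ?_⟩
  have ho : (o k : ℕ) < b := (o k).isLt
  have ho' : (o' k : ℕ) < b := (o' k).isLt
  simp only [cubeUnmirror]
  split_ifs <;> first | omega | (simp only [Fin.val_rev]; omega)

omit [NeZero N] [NeZero b] in
/-- Raising the `k`-th offset by one is the unit step `+e_k` on the torus.
[cite: FriedliVelenik2017, §10.2] -/
private theorem pcti_blockSite_succ (c' : BlockIdx d N) {o o' : Fin d → Fin b} {k : Fin d}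
    (hl : ∀ l, l ≠ k → o' l = o l) (hk : (o' k : ℕ) = (o k : ℕ) + 1) :
    blockSite N b (c', o') = blockSite N b (c', o) + Pi.single k 1 := by
  funext l
  simp only [blockSite, Pi.add_apply]
  by_cases h : l = k
  · subst h
    rw [Pi.single_eq_same, hk, Nat.cast_add, Nat.cast_one, add_assoc]
  · rw [Pi.single_eq_of_ne h, add_zero, hl l h]

/-- The images in the cube `c'` of an oriented dipole `⟨i, i + e_k⟩` of one cube are nearest
neighbours. [cite: FrohlichLieb1978, eqs. (1.35), (1.41)] -/
private theorem pcti_img_adj_of_eq_add [NeZero (N * b)] (hN : Even N) (hN1 : 1 < N)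
    (hL : 2 < N * b) {v i j : TorusSite d (N * b)} {k : Fin d} (hk : j = i + Pi.single k 1)
    (hblk : blockOf N b (i - v) = blockOf N b (j - v)) (c' : BlockIdx d N) :
    (torusGraph d (N * b)).Adj (pcti_img hN (blockOf N b (i - v)) c' (offsetOf N b (i - v)))
      (pcti_img hN (blockOf N b (i - v)) c' (offsetOf N b (j - v))) := by
  have hjv : j - v = (i - v) + Pi.single k 1 := by rw [hk]; abel
  have hblk' : blockOf N b ((i - v) + Pi.single k 1) = blockOf N b (i - v) := by rw [← hjv, hblk]
  obtain ⟨hl, hkk⟩ := pcti_offsetOf_add_single hN1 hblk'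
  rw [← hjv] at hl hkk
  obtain ⟨hl2, hk2 | hk2⟩ := pcti_unmirror_step hN (blockOf N b (i - v)) c' hl hkk
  · rw [pcti_img, pcti_img, pcti_blockSite_succ c' hl2 hk2]
    exact torusGraph_adj_add_single _ hL.le _ k
  · rw [pcti_img, pcti_img, pcti_blockSite_succ c' (fun l hl' => (hl2 l hl').symm) hk2]
    exact (torusGraph_adj_add_single _ hL.le _ k).symm

/-- **The images of a nearest-neighbour dipole of one cube are nearest neighbours in every cube.**
[cite: FrohlichLieb1978, eqs. (1.35), (1.41)] -/
private theorem pcti_img_adj [NeZero (N * b)] (hN : Even N) (hN1 : 1 < N) (hL : 2 < N * b)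
    {v i j : TorusSite d (N * b)} (hij : ∃ k : Fin d, j = i + Pi.single k 1 ∨ i = j + Pi.single k 1)
    (hblk : blockOf N b (i - v) = blockOf N b (j - v)) (c' : BlockIdx d N) :
    (torusGraph d (N * b)).Adj (pcti_img hN (blockOf N b (i - v)) c' (offsetOf N b (i - v)))
      (pcti_img hN (blockOf N b (i - v)) c' (offsetOf N b (j - v))) := by
  obtain ⟨k, hk | hk⟩ := hij
  · exact pcti_img_adj_of_eq_add hN hN1 hL hk hblk c'
  · have h := pcti_img_adj_of_eq_add hN hN1 hL hk hblk.symm c'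
    rw [← hblk] at h
    exact h.symm

/-- The universal dipole projection as a diagonal matrix: its factor at `y` is `diag(w_y)` with
`w_y = 𝟙[2k ≤ n]` if `y` reads `i`, `𝟙[2k > n]` if `y` reads `j`, `1` otherwise.
[cite: FrohlichLieb1978, eqs. (1.35), (1.45)] -/
private theorem pcti_pattern_eq_diagonal {n : ℕ} (hN : Even N) (v i j : TorusSite d (N * b))
    (y : TorusSite d (N * b)) :
    cubePattern hN v (selectedOp (szNonnegProj n) (szNegProj n) {i} {j}) (blockOf N b (i - v))
        (mirroredOffset hN y) =
      diagonal (if blockSite N b (blockOf N b (i - v), cubeUnmirror hN (blockOf N b (i - v))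
            (mirroredOffset hN y)) + v ∈ ({i} : Finset _) then pcti_up n
        else if blockSite N b (blockOf N b (i - v), cubeUnmirror hN (blockOf N b (i - v))
            (mirroredOffset hN y)) + v ∈ ({j} : Finset _) then pcti_dn n
        else 1) := by
  simp only [cubePattern, selectedOp]
  split_ifs
  · rfl
  · rfl
  · exact diagonal_one.symm

/-- **Every configuration in the range of the universal dipole projection has `S³ ≥ 0` at the
image of `i` and `S³ < 0` at the image of `j` in every cube** (a broken bond per cube).
[cite: FrohlichLieb1978, eqs. (1.35), (1.45), §III (3.4)] -/
private theorem pcti_compat_of_ne_zero {n : ℕ} (hN : Even N) {v i j : TorusSite d (N * b)}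
    (hji : j ≠ i) (hblk : blockOf N b (i - v) = blockOf N b (j - v))
    (w : TorusSite d (N * b) → Fin (n + 1) → ℂ)
    (hw : ∀ y, cubePattern hN v (selectedOp (szNonnegProj n) (szNegProj n) {i} {j})
      (blockOf N b (i - v)) (mirroredOffset hN y) = diagonal (w y))
    {σ : TensorIndex (TorusSite d (N * b)) (n + 1)} (hσ : ∏ y, w y (σ y) ≠ 0) (c' : BlockIdx d N) :
    2 * (σ (pcti_img hN (blockOf N b (i - v)) c' (offsetOf N b (i - v))) : ℕ) ≤ n ∧
      ¬ 2 * (σ (pcti_img hN (blockOf N b (i - v)) c' (offsetOf N b (j - v))) : ℕ) ≤ n := by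
  have hall := prod_ne_zero_iff.1 hσ
  constructor
  · have h1 := hw (pcti_img hN (blockOf N b (i - v)) c' (offsetOf N b (i - v)))
    rw [pcti_pattern_eq_diagonal, pcti_phi_img, if_pos (mem_singleton_self i)] at h1
    have h2 := congrFun (diagonal_injective h1)
      (σ (pcti_img hN (blockOf N b (i - v)) c' (offsetOf N b (i - v))))
    have h3 := hall (pcti_img hN (blockOf N b (i - v)) c' (offsetOf N b (i - v))) (mem_univ _)
    rw [← h2] at h3
    simp only [pcti_up] at h3
    by_contra hc
    exact h3 (if_neg hc)
  · have h1 := hw (pcti_img hN (blockOf N b (i - v)) c' (offsetOf N b (j - v)))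
    rw [pcti_pattern_eq_diagonal] at h1
    conv at h1 => lhs; rw [hblk, pcti_phi_img]
    rw [if_neg (by rwa [mem_singleton]), if_pos (mem_singleton_self j)] at h1
    have h2 := congrFun (diagonal_injective h1)
      (σ (pcti_img hN (blockOf N b (i - v)) c' (offsetOf N b (j - v))))
    have h3 := hall (pcti_img hN (blockOf N b (i - v)) c' (offsetOf N b (j - v))) (mem_univ _)
    rw [← h2] at h3
    simp only [pcti_dn] at h3
    intro hc
    exact h3 (if_pos hc)

/-- **Peierls energy estimate for the universal dipole projection**: a configuration with a broken
bond (`S³ ≥ 0`, `S³ < 0`) at the image dipole of every one of the `N^d` cubes has Ising-type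
energy `≥ E₀ + (n²/4)·N^d`. [cite: FrohlichLieb1978, §I.B, §III eqs. (3.4)–(3.7)] -/
private theorem pcti_energy_ge {n : ℕ} [NeZero (N * b)] (hN : Even N) (hN1 : 1 < N)
    (hL : 2 < N * b) {v i j : TorusSite d (N * b)}
    (hij : ∃ k : Fin d, j = i + Pi.single k 1 ∨ i = j + Pi.single k 1)
    (hblk : blockOf N b (i - v) = blockOf N b (j - v))
    {σ : TensorIndex (TorusSite d (N * b)) (n + 1)}
    (hσ : ∀ c' : BlockIdx d N,
      2 * (σ (pcti_img hN (blockOf N b (i - v)) c' (offsetOf N b (i - v))) : ℕ) ≤ n ∧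
        ¬ 2 * (σ (pcti_img hN (blockOf N b (i - v)) c' (offsetOf N b (j - v))) : ℕ) ≤ n) :
    isingTypeEnergy n (N * b) (fun _ : TorusSite d (N * b) => (0 : Fin (n + 1))) +
        (n : ℝ) ^ 2 / 4 * (N : ℝ) ^ d ≤ isingTypeEnergy n (N * b) σ := by
  classical
  set E := (torusGraph d (N * b)).edgeFinset with hE
  set f : Sym2 (TorusSite d (N * b)) → ℝ :=
    Sym2.lift ⟨fun x y => -(szVal n (σ x) * szVal n (σ y)), fun _ _ => by ring⟩ with hf
  -- the broken bonds, one per cube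
  set bond : BlockIdx d N → Sym2 (TorusSite d (N * b)) := fun c' =>
    s(pcti_img hN (blockOf N b (i - v)) c' (offsetOf N b (i - v)),
      pcti_img hN (blockOf N b (i - v)) c' (offsetOf N b (j - v))) with hbond
  set B := (univ : Finset (BlockIdx d N)).image bond with hB
  have hBE : B ⊆ E := by
    intro e he
    obtain ⟨c', -, rfl⟩ := mem_image.1 he
    rw [hE, SimpleGraph.mem_edgeFinset, hbond, SimpleGraph.mem_edgeSet]
    exact pcti_img_adj hN hN1 hL hij hblk c'
  have hinj : Function.Injective bond := by
    intro c₁ c₂ h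
    rcases Sym2.eq_iff.1 h with ⟨h1, -⟩ | ⟨h1, -⟩
    · have := congrArg (blockOf N b) h1
      rwa [pcti_blockOf_img, pcti_blockOf_img] at this
    · have := congrArg (blockOf N b) h1
      rwa [pcti_blockOf_img, pcti_blockOf_img] at this
  have hBcard : B.card = N ^ d := by
    rw [hB, card_image_of_injective _ hinj, card_univ, Fintype.card_pi, prod_const, ZMod.card,
      card_univ, Fintype.card_fin]
  have hfB : ∀ e ∈ B, 0 ≤ f e := by
    intro e he
    obtain ⟨c', -, rfl⟩ := mem_image.1 he
    obtain ⟨hp, hm⟩ := hσ c'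
    simp only [hf, hbond, Sym2.lift_mk, neg_nonneg]
    refine mul_nonpos_of_nonneg_of_nonpos ?_ ?_
    · rw [szVal, sub_nonneg]
      have : (2 * (σ (pcti_img hN (blockOf N b (i - v)) c' (offsetOf N b (i - v))) : ℕ) : ℝ) ≤ n :=
        by exact_mod_cast hp
      linarith
    · rw [szVal, sub_nonpos]
      have : (n : ℝ) < 2 * (σ (pcti_img hN (blockOf N b (i - v)) c' (offsetOf N b (j - v))) : ℕ) :=
        by exact_mod_cast Nat.lt_of_not_le hm
      linarith
  have hsplit : ∑ e ∈ E, f e = ∑ e ∈ E \ B, f e + ∑ e ∈ B, f e := (sum_sdiff hBE).symm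
  have hrest : ((E \ B).card : ℝ) * (-((n : ℝ) ^ 2 / 4)) ≤ ∑ e ∈ E \ B, f e := by
    rw [← nsmul_eq_mul, ← sum_const]
    exact sum_le_sum fun e _ => neg_le_isingTypeBond n (N * b) σ e
  have hcardsd : ((E \ B).card : ℝ) = E.card - B.card := by
    rw [eq_sub_iff_add_eq, ← Nat.cast_add, card_sdiff_add_card_eq_card hBE]
  have hBcardR : (B.card : ℝ) = (N : ℝ) ^ d := by rw [hBcard, Nat.cast_pow]
  have hB0 : 0 ≤ ∑ e ∈ B, f e := sum_nonneg hfB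
  rw [isingTypeEnergy_zero, show isingTypeEnergy n (N * b) σ = ∑ e ∈ E, f e from rfl, hsplit,
    ← hE]
  rw [hcardsd, hBcardR] at hrest
  linarith

end Dipole

/-! ### The smallness datum `κ = (n+1)^{b²} e^{-βn²/4}` and the end-to-end bounds (`d = 2`) -/

section Bounds

variable {N b : ℕ} [NeZero N] [NeZero b] (n : ℕ)

/-- **The Peierls smallness datum of the Ising-type model** with cubes of side `b`:
`κ = (n+1)^{b²} e^{-βn²/4}` (local entropy `(n+1)^{b²}` per cube, energy `n²/4` per broken bond).
[cite: FrohlichLieb1978, eqs. (1.45)–(1.47), §III (3.4)–(3.7)] -/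
def isingTypeKappa (n b : ℕ) (β : ℝ) : ℝ := ((n : ℝ) + 1) ^ (b ^ 2) * Real.exp (-(β * n ^ 2 / 4))

/-- `κ > 0`. [cite: FrohlichLieb1978, eq. (1.47)] -/
theorem isingTypeKappa_pos (n b : ℕ) (β : ℝ) : 0 < isingTypeKappa n b β :=
  mul_pos (pow_pos (by positivity) _) (Real.exp_pos _)

/-- **FL (1.45)–(1.47) for the Ising-type model: `Re⟨P_Λ⟩_β ≤ κ^{N²}`.** On the torus `(ℤ/Nbℤ)²`
(`N > 1` even, `Nb > 2`, `β ≥ 0`), for every shift `v` and every nearest-neighbour dipole `⟨i, j⟩`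
of one cube of the shifted partition, the universal projection obtained by tiling `Pᵢ⁺Pⱼ⁻` over
all cubes with mirror images has `Re⟨P_Λ⟩_β ≤ ((n+1)^{b²} e^{-βn²/4})^{N²}`: it commutes with
`H = -Σ S³S³`, its range has energy `≥ E₀ + N²n²/4` (a broken bond in every cube) and its trace is
`≤ (n+1)^{(Nb)²}`. [cite: FrohlichLieb1978, eqs. (1.45)–(1.47), §III eqs. (3.4)–(3.7)] -/
theorem isingType_dipole_le [NeZero (N * b)] (hN : Even N) (hN1 : 1 < N) (hL : 2 < N * b)
    {β : ℝ} (hβ : 0 ≤ β) (v i j : TorusSite 2 (N * b))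
    (hij : ∃ k : Fin 2, j = i + Pi.single k 1 ∨ i = j + Pi.single k 1)
    (hblk : blockOf N b (i - v) = blockOf N b (j - v)) :
    (Matrix.gibbsState β (xyzRealFieldHamiltonian (N * b) n 0 0 0)
      (productOp fun y => cubePattern hN v (selectedOp (szNonnegProj n) (szNegProj n) {i} {j})
        (blockOf N b (i - v)) (mirroredOffset hN y))).re ≤ isingTypeKappa n b β ^ (N ^ 2) := by
  classical
  haveI : Fact (1 < N * b) := ⟨by omega⟩
  have hji : j ≠ i := by
    rintro rfl
    obtain ⟨k, hk | hk⟩ := hij <;>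
    · have h0 : (0 : TorusSite 2 (N * b)) = Pi.single k 1 :=
        add_left_cancel (a := j) (by rw [add_zero]; exact hk)
      have h1 := congrFun h0 k
      rw [Pi.zero_apply, Pi.single_eq_same] at h1
      exact zero_ne_one h1
  -- the factors are diagonal
  set w : TorusSite 2 (N * b) → Fin (n + 1) → ℂ := fun y =>
    if blockSite N b (blockOf N b (i - v), cubeUnmirror hN (blockOf N b (i - v))
        (mirroredOffset hN y)) + v ∈ ({i} : Finset _) then pcti_up n
    else if blockSite N b (blockOf N b (i - v), cubeUnmirror hN (blockOf N b (i - v))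
        (mirroredOffset hN y)) + v ∈ ({j} : Finset _) then pcti_dn n
    else 1 with hw_def
  have hw : ∀ y, cubePattern hN v (selectedOp (szNonnegProj n) (szNegProj n) {i} {j})
      (blockOf N b (i - v)) (mirroredOffset hN y) = diagonal (w y) := fun y =>
    pcti_pattern_eq_diagonal hN v i j y
  have hw01 : ∀ y k, w y k = 0 ∨ w y k = 1 := by
    intro y k
    simp only [hw_def]
    split_ifs
    · exact pcti_up01 n k
    · exact pcti_dn01 n k
    · exact Or.inr rfl
  set W : TensorIndex (TorusSite 2 (N * b)) (n + 1) → ℂ := fun σ => ∏ y, w y (σ y) with hW_def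
  have hW01 : ∀ σ, W σ = 0 ∨ W σ = 1 := by
    intro σ
    by_cases h : ∃ y, w y (σ y) = 0
    · obtain ⟨y, hy⟩ := h
      exact Or.inl (prod_eq_zero (mem_univ y) hy)
    · push Not at h
      exact Or.inr (prod_eq_one fun y _ => (hw01 y (σ y)).resolve_left (h y))
  have hP : (productOp fun y => cubePattern hN v (selectedOp (szNonnegProj n) (szNegProj n) {i} {j})
      (blockOf N b (i - v)) (mirroredOffset hN y)) = diagonal W := by
    rw [show (fun y => cubePattern hN v (selectedOp (szNonnegProj n) (szNegProj n) {i} {j})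
      (blockOf N b (i - v)) (mirroredOffset hN y)) = fun y => diagonal (w y) from funext hw]
    exact pcti_productOp_diagonal w
  -- the Hamiltonian is diagonal
  set Eσ : TensorIndex (TorusSite 2 (N * b)) (n + 1) → ℝ := isingTypeEnergy n (N * b) with hE_def
  have hH : xyzRealFieldHamiltonian (N * b) n 0 0 0 = diagonal fun σ => ((Eσ σ : ℝ) : ℂ) :=
    xyzRealFieldHamiltonian_zero_eq_diagonal n (N * b)
  have hHh : (xyzRealFieldHamiltonian (d := 2) (N * b) n 0 0 0).IsHermitian :=
    xyzRealFieldHamiltonian_isHermitian (N * b) n _ _ 0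
  -- projection data
  have hWstar : star W = W := by
    funext σ
    rw [Pi.star_apply]
    rcases hW01 σ with h | h <;> rw [h] <;> simp
  have hPh : (diagonal W).IsHermitian := by
    rw [IsHermitian, diagonal_conjTranspose, hWstar]
  have hP2 : diagonal W * diagonal W = diagonal W := by
    rw [diagonal_mul_diagonal]
    congr 1
    funext σ
    rcases hW01 σ with h | h <;> rw [h] <;> simp
  have hcomm : diagonal W * xyzRealFieldHamiltonian (N * b) n 0 0 0 =
      xyzRealFieldHamiltonian (N * b) n 0 0 0 * diagonal W := by
    rw [hH, diagonal_mul_diagonal, diagonal_mul_diagonal]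
    congr 1
    funext σ
    exact mul_comm _ _
  -- the energy of the constrained sector
  set E₀ : ℝ := isingTypeEnergy n (N * b) (fun _ : TorusSite 2 (N * b) => (0 : Fin (n + 1)))
    with hE₀
  set e : ℝ := E₀ + (n : ℝ) ^ 2 / 4 * (N : ℝ) ^ 2 with he_def
  have he : ∀ u : TensorIndex (TorusSite 2 (N * b)) (n + 1) → ℂ, diagonal W *ᵥ u = u →
      e * (star u ⬝ᵥ u).re ≤ (star u ⬝ᵥ xyzRealFieldHamiltonian (N * b) n 0 0 0 *ᵥ u).re := by
    intro u hu
    rw [hH, dotProduct, dotProduct, Complex.re_sum, Complex.re_sum, mul_sum]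
    refine sum_le_sum fun σ _ => ?_
    rw [mulVec_diagonal, Pi.star_apply, Complex.star_def, ← mul_assoc, mul_comm _ (((Eσ σ : ℝ)) : ℂ),
      mul_assoc, ← Complex.normSq_eq_conj_mul_self, Complex.re_ofReal_mul, Complex.ofReal_re]
    by_cases hz : u σ = 0
    · rw [hz, map_zero, mul_zero, mul_zero]
    · have hWσ : W σ ≠ 0 := by
        intro h0
        have := congrFun hu σ
        rw [mulVec_diagonal, h0, zero_mul] at this
        exact hz this.symm
      have hcompat := pcti_compat_of_ne_zero hN hji hblk w hw hWσ
      have hge := pcti_energy_ge hN hN1 hL hij hblk hcompat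
      exact mul_le_mul_of_nonneg_right hge (Complex.normSq_nonneg _)
  -- the variational ground-state bound with the aligned configuration
  set φ : TensorIndex (TorusSite 2 (N * b)) (n + 1) → ℂ := Pi.single (fun _ => 0) 1 with hφ
  have hφ1 : star φ ⬝ᵥ φ = 1 := by
    rw [hφ, dotProduct_single, Pi.star_apply, Pi.single_eq_same, star_one, mul_one]
  have hφE : (star φ ⬝ᵥ xyzRealFieldHamiltonian (N * b) n 0 0 0 *ᵥ φ).re = E₀ := by
    rw [hH, hφ, diagonal_mulVec_single, dotProduct_single, Pi.star_apply, Pi.single_eq_same,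
      star_one, mul_one, one_mul, Complex.ofReal_re]
  haveI : Nonempty (TensorIndex (TorusSite 2 (N * b)) (n + 1)) := ⟨fun _ => 0⟩
  have hmain := Matrix.gibbsState_re_le_trace_mul_exp_rayleigh hHh hPh hP2 hcomm hβ he hφ1
  rw [hφE, show e - E₀ = (n : ℝ) ^ 2 / 4 * (N : ℝ) ^ 2 by rw [he_def]; ring] at hmain
  -- the trace
  have htr : ((diagonal W).trace).re ≤ ((n : ℝ) + 1) ^ ((N * b) ^ 2) := by
    rw [trace_diagonal, Complex.re_sum]
    calc ∑ σ, (W σ).re ≤ ∑ _σ : TensorIndex (TorusSite 2 (N * b)) (n + 1), (1 : ℝ) :=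
          sum_le_sum fun σ _ => by rcases hW01 σ with h | h <;> rw [h] <;> simp
      _ = ((n : ℝ) + 1) ^ ((N * b) ^ 2) := by
          rw [sum_const, card_univ, nsmul_eq_mul, mul_one, Fintype.card_fun, Fintype.card_fin,
            Fintype.card_fun, ZMod.card, Fintype.card_fin]
          push_cast
          ring
  rw [hP]
  refine hmain.trans ?_
  calc ((diagonal W).trace).re * Real.exp (-(β * ((n : ℝ) ^ 2 / 4 * (N : ℝ) ^ 2)))
      ≤ ((n : ℝ) + 1) ^ ((N * b) ^ 2) * Real.exp (-(β * ((n : ℝ) ^ 2 / 4 * (N : ℝ) ^ 2))) :=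
        mul_le_mul_of_nonneg_right htr (Real.exp_pos _).le
    _ = isingTypeKappa n b β ^ (N ^ 2) := by
        rw [isingTypeKappa, mul_pow (((n : ℝ) + 1) ^ (b ^ 2)), ← pow_mul, ← Real.exp_nat_mul]
        congr 2
        · ring
        · push_cast; ring

omit [NeZero N] [NeZero b] in
/-- Reflection positivity of `-β(-Σ S³S³)` across the planes between the cubes (the member
`s₁ = s₂ = 0` of `xyzReal_isRPExponent`). [cite: BjornbergUeltschi2022, Lemma 5.2] -/
private theorem pcti_isRPExponent [NeZero (N * b)] (hN : Even N) {β : ℝ} (hβ : 0 ≤ β)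
    (i : Fin 2) (k : ZMod N) :
    IsRPExponent (N * b) i (blockPlane N b k) (hN.mul_right b)
      (-(β : ℂ) • xyzRealFieldHamiltonian (N * b) n 0 0 0) := by
  simpa using xyzReal_isRPExponent (N * b) n (hN.mul_right b) (0 : ℝ) (0 : ℝ) hβ i
    (blockPlane N b k)

/-- **Volume-uniform two-point bound for the Ising-type model, unconditionally.** On `(ℤ/Nbℤ)²`
(`N > 1` even, `Nb > 2`), for every spin `n/2`, every `β ≥ 0` with
`κ = (n+1)^{b²}e^{-βn²/4} ≤ 1` and `ρ = 4·19⁶·κ^{(b-1)/b⁵} < 1`: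
`Re⟨Pₘ⁺Pₙ⁻⟩_β ≤ 4ρ/(1-ρ)²` for all `m ≠ n`, `P± = 𝟙[S³ ≥ 0], 𝟙[S³ < 0]`.
[cite: FrohlichLieb1978, Thm. 1.1, Cor. 1.2, eqs. (1.44)–(1.47)] [cite: Peierls1936] -/
theorem isingType_twoPoint_le [NeZero (N * b)] (hN : Even N) (hN1 : 1 < N) (hL : 2 < N * b)
    {β : ℝ} (hβ : 0 ≤ β) (hκ1 : isingTypeKappa n b β ≤ 1)
    (hρ : 4 * 19 ^ 6 * isingTypeKappa n b β ^ (((b - 1 : ℕ) : ℝ) / (b : ℝ) ^ (2 * 2 + 1)) < 1)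
    {m n' : TorusSite 2 (N * b)} (hmn : m ≠ n') :
    (Matrix.gibbsState β (xyzRealFieldHamiltonian (N * b) n 0 0 0)
        (onSite m (szNonnegProj n) * onSite n' (szNegProj n))).re ≤
      4 * (4 * 19 ^ 6 * isingTypeKappa n b β ^ (((b - 1 : ℕ) : ℝ) / (b : ℝ) ^ (2 * 2 + 1))) /
        (1 - 4 * 19 ^ 6 * isingTypeKappa n b β ^ (((b - 1 : ℕ) : ℝ) / (b : ℝ) ^ (2 * 2 + 1))) ^ 2 :=
  peierls_chessboard_twoPoint_le hN hN1 hL (xyzRealFieldHamiltonian_isHermitian (N * b) n _ _ 0)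
    (pcti_isRPExponent n hN hβ) (xyzRealFieldHamiltonian_submatrix_comp_addRight (N * b) n _ _)
    (szNonnegProj_posSemidef n) (szNegProj_posSemidef n) (szNonnegProj_add_szNegProj n)
    (szNonnegProj_map_starRingEnd n) (szNegProj_map_starRingEnd n) (isingTypeKappa_pos n b β) hκ1
    (fun v i j hij hblk => isingType_dipole_le n hN hN1 hL hβ v i j hij hblk) hρ hmn

/-- **Long-range order of the Ising-type model, unconditionally** (FL (1.9) with `M² = 1/2` for
the order observable `σ = P⁺ - P⁻ = sgn S³`): on `(ℤ/Nbℤ)²` (`N > 1` even, `Nb > 2`), for every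
spin `n/2` and every `β ≥ 0` with `κ = (n+1)^{b²}e^{-βn²/4} ≤ 1` and `κ^{(b-1)/b⁵} ≤ 10⁻¹⁰`:
`Re⟨σₘσₙ⟩_β ≥ 1/2` for all `m ≠ n`, uniformly in `N`.
[cite: FrohlichLieb1978, §I (i), eq. (1.9), Thm. 1.1, Cor. 1.2, eqs. (1.44)–(1.47)]
[cite: Peierls1936] -/
theorem isingType_sigma_twoPoint_ge_half [NeZero (N * b)] (hN : Even N) (hN1 : 1 < N)
    (hL : 2 < N * b) {β : ℝ} (hβ : 0 ≤ β) (hκ1 : isingTypeKappa n b β ≤ 1)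
    (hθ : isingTypeKappa n b β ^ (((b - 1 : ℕ) : ℝ) / (b : ℝ) ^ (2 * 2 + 1)) ≤ 1 / 10 ^ 10)
    {m n' : TorusSite 2 (N * b)} (hmn : m ≠ n') :
    (1 : ℝ) / 2 ≤ (Matrix.gibbsState β (xyzRealFieldHamiltonian (N * b) n 0 0 0)
        (onSite m (szNonnegProj n - szNegProj n) * onSite n' (szNonnegProj n - szNegProj n))).re :=
  peierls_chessboard_sigma_twoPoint_ge_half hN hN1 hL
    (xyzRealFieldHamiltonian_isHermitian (N * b) n _ _ 0) (pcti_isRPExponent n hN hβ)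
    (xyzRealFieldHamiltonian_submatrix_comp_addRight (N * b) n _ _)
    (szNonnegProj_posSemidef n) (szNegProj_posSemidef n) (szNonnegProj_add_szNegProj n)
    (szNonnegProj_map_starRingEnd n) (szNegProj_map_starRingEnd n) (isingTypeKappa_pos n b β) hκ1
    (fun v i j hij hblk => isingType_dipole_le n hN hN1 hL hβ v i j hij hblk) hθ hmn

/-! ### The spin-½ Ising model on `(ℤ/2Nℤ)²` at `β ≥ 3000` -/

/-- The numerical threshold: for `β ≥ 3000`, `κ = 16e^{-β/4} ≤ 10⁻³²⁰` (`e ≥ 2.7`,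
`2.7⁷⁵⁰ ≥ 16·10³²⁰`). [cite: FrohlichLieb1978, eq. (1.47)] -/
private theorem pcti_kappa_half_le {β : ℝ} (hβ : 3000 ≤ β) :
    isingTypeKappa 1 2 β ≤ 1 / 10 ^ 320 := by
  have h1 : (2.7 : ℝ) ≤ Real.exp 1 := by linarith [Real.exp_one_gt_d9]
  have h2 : (2.7 : ℝ) ^ 750 ≤ Real.exp 750 := by
    rw [show (750 : ℝ) = (750 : ℕ) * 1 by norm_num, Real.exp_nat_mul]
    exact pow_le_pow_left₀ (by norm_num) h1 750
  have h3 : (16 : ℝ) * 10 ^ 320 ≤ (2.7 : ℝ) ^ 750 := by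
    rw [show (10 : ℝ) ^ 320 = (10 ^ 160) ^ 2 by rw [← pow_mul],
      show (2.7 : ℝ) ^ 750 = (2.7 ^ 250) ^ 3 by rw [← pow_mul]]
    norm_num
  have h4 : Real.exp 750 ≤ Real.exp (β / 4) := Real.exp_le_exp.2 (by linarith)
  have hpos : 0 < Real.exp (β / 4) := Real.exp_pos _
  have hk : isingTypeKappa 1 2 β = 16 / Real.exp (β / 4) := by
    rw [isingTypeKappa, show β * ((1 : ℕ) : ℝ) ^ 2 / 4 = β / 4 by push_cast; ring, Real.exp_neg,
      div_eq_mul_inv (16 : ℝ)]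
    norm_num
  rw [hk, div_le_div_iff₀ hpos (by positivity), one_mul]
  generalize (2.7 : ℝ) ^ 750 = A at h2 h3
  generalize (10 : ℝ) ^ 320 = T at h3 ⊢
  linarith

/-- **Long-range order in the two-dimensional spin-½ Ising model `H = -Σ S³S³` at `β ≥ 3000`,
uniformly in the volume** (order observable `σᶻ = 2S³ = P⁺ - P⁻`): for every even `N > 1`, every
`β ≥ 3000` and all sites `m ≠ n` of the torus `(ℤ/2Nℤ)²`, `⟨σᶻₘσᶻₙ⟩_β ≥ 1/2` — by reflection
positivity, the chessboard estimate and the Peierls contour bound (cubes of side `b = 2`,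
`κ = 16e^{-β/4} ≤ 10⁻³²⁰`). [cite: FrohlichLieb1978, §I (i), eq. (1.9), Thm. 1.1, Cor. 1.2]
[cite: Peierls1936] -/
theorem isingHalf_sigma_twoPoint_ge_half [NeZero (N * 2)] (hN : Even N) (hN1 : 1 < N) {β : ℝ}
    (hβ : 3000 ≤ β) {m n' : TorusSite 2 (N * 2)} (hmn : m ≠ n') :
    (1 : ℝ) / 2 ≤ (Matrix.gibbsState β (xyzRealFieldHamiltonian (N * 2) 1 0 0 0)
        (onSite m (szNonnegProj 1 - szNegProj 1) * onSite n' (szNonnegProj 1 - szNegProj 1))).re := by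
  have hκ := pcti_kappa_half_le hβ
  have hκ0 := isingTypeKappa_pos 1 2 β
  have hκ1 : isingTypeKappa 1 2 β ≤ 1 :=
    hκ.trans (by rw [one_div]; exact inv_le_one_of_one_le₀ (one_le_pow₀ (by norm_num)))
  refine isingType_sigma_twoPoint_ge_half 1 hN hN1 (by omega) (by linarith) hκ1 ?_ hmn
  have hexp : (((2 - 1 : ℕ) : ℝ) / ((2 : ℕ) : ℝ) ^ (2 * 2 + 1)) = ((32 : ℕ) : ℝ)⁻¹ := by norm_num
  rw [hexp]
  calc isingTypeKappa 1 2 β ^ (((32 : ℕ) : ℝ)⁻¹)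
      ≤ ((1 : ℝ) / 10 ^ 320) ^ (((32 : ℕ) : ℝ)⁻¹) := Real.rpow_le_rpow hκ0.le hκ (by positivity)
    _ = 1 / 10 ^ 10 := by
        rw [show (1 : ℝ) / 10 ^ 320 = (1 / 10 ^ 10) ^ 32 by rw [div_pow, one_pow, ← pow_mul],
          Real.pow_rpow_inv_natCast (by positivity) (by norm_num)]

/-- **`⟨S³ₘS³ₙ⟩_β ≥ 1/8` in the two-dimensional spin-½ Ising model at `β ≥ 3000`, all `m ≠ n`,
every even linear size `2N ≥ 4`** — Peierls' theorem, here obtained end to end from the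
Fröhlich–Lieb reflection-positivity/chessboard/Peierls chain of the tree.
[cite: Peierls1936] [cite: FrohlichLieb1978, §I (i), eq. (1.9), Thm. 1.1, Cor. 1.2] -/
theorem isingHalf_szsz_ge [NeZero (N * 2)] (hN : Even N) (hN1 : 1 < N) {β : ℝ} (hβ : 3000 ≤ β)
    {m n' : TorusSite 2 (N * 2)} (hmn : m ≠ n') :
    (1 : ℝ) / 8 ≤ (Matrix.gibbsState β (xyzRealFieldHamiltonian (N * 2) 1 0 0 0)
        (siteSpin 1 m 2 * siteSpin 1 n' 2)).re := by
  have h := isingHalf_sigma_twoPoint_ge_half hN hN1 hβ hmn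
  have hobs : onSite m (szNonnegProj 1 - szNegProj 1) * onSite n' (szNonnegProj 1 - szNegProj 1) =
      (((4 : ℝ) : ℂ)) • (siteSpin 1 m 2 * siteSpin 1 n' 2 :
        Op (TorusSite 2 (N * 2)) (1 + 1)) := by
    rw [szNonnegProj_sub_szNegProj_one, onSite_smul', onSite_smul', siteSpin, siteSpin, spinVec_two,
      smul_mul_smul_comm]
    norm_num
  rw [hobs, map_smul, smul_eq_mul, Complex.re_ofReal_mul] at h
  linarith

end Bounds

/-! ### The universal dipole projection, packaged for the quantum models (FL §III) -/

section DipolePackage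

variable {d N b : ℕ} [NeZero N] [NeZero b] (n : ℕ)

/-- **The universal dipole projection is a `0/1` diagonal matrix whose range has a broken bond in
every cube** (the classical input of FL §III for the QUANTUM models, where `P_Λ` no longer commutes
with `H` but is still an eigenprojection of `A = S⁻²H^z`, (3.18)–(3.19), with
`ℰ^z(P_Λ) ≥ e₀^z + (energy of one broken bond per cube)`, (3.30)): on the torus `(ℤ/Nbℤ)^d`
(`N > 1` even, `Nb > 2`), for every shift `v` and every nearest-neighbour dipole `⟨i, j⟩` of one
cube of the shifted partition, the universal projection obtained by tiling `Pᵢ⁺Pⱼ⁻`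
(`P⁺ = 𝟙[S³ ≥ 0]`, `P⁻ = 𝟙[S³ < 0]`) over all cubes with mirror images is `diagonal W` with
`W ∈ {0, 1}`, and every basis configuration `σ` with `W σ ≠ 0` has Ising-type energy
`E(σ) ≥ E(Ω) + (n²/4)·N^d` (`Ω` the aligned configuration).
[cite: FrohlichLieb1978, eqs. (1.35), (1.45), (3.18)–(3.19), (3.30)] -/
theorem exists_dipolePattern_eq_diagonal [NeZero (N * b)] (hN : Even N) (hN1 : 1 < N)
    (hL : 2 < N * b) (v i j : TorusSite d (N * b))
    (hij : ∃ k : Fin d, j = i + Pi.single k 1 ∨ i = j + Pi.single k 1)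
    (hblk : blockOf N b (i - v) = blockOf N b (j - v)) :
    ∃ W : TensorIndex (TorusSite d (N * b)) (n + 1) → ℂ,
      (∀ σ, W σ = 0 ∨ W σ = 1) ∧
      (productOp fun y => cubePattern hN v (selectedOp (szNonnegProj n) (szNegProj n) {i} {j})
          (blockOf N b (i - v)) (mirroredOffset hN y)) = diagonal W ∧
      ∀ σ, W σ ≠ 0 →
        isingTypeEnergy n (N * b) (fun _ : TorusSite d (N * b) => (0 : Fin (n + 1))) +
            (n : ℝ) ^ 2 / 4 * (N : ℝ) ^ d ≤ isingTypeEnergy n (N * b) σ := by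
  classical
  haveI : Fact (1 < N * b) := ⟨by omega⟩
  have hji : j ≠ i := by
    rintro rfl
    obtain ⟨k, hk | hk⟩ := hij <;>
    · have h0 : (0 : TorusSite d (N * b)) = Pi.single k 1 :=
        add_left_cancel (a := j) (by rw [add_zero]; exact hk)
      have h1 := congrFun h0 k
      rw [Pi.zero_apply, Pi.single_eq_same] at h1
      exact zero_ne_one h1
  set w : TorusSite d (N * b) → Fin (n + 1) → ℂ := fun y =>
    if blockSite N b (blockOf N b (i - v), cubeUnmirror hN (blockOf N b (i - v))
        (mirroredOffset hN y)) + v ∈ ({i} : Finset _) then pcti_up n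
    else if blockSite N b (blockOf N b (i - v), cubeUnmirror hN (blockOf N b (i - v))
        (mirroredOffset hN y)) + v ∈ ({j} : Finset _) then pcti_dn n
    else 1 with hw_def
  have hw : ∀ y, cubePattern hN v (selectedOp (szNonnegProj n) (szNegProj n) {i} {j})
      (blockOf N b (i - v)) (mirroredOffset hN y) = diagonal (w y) := fun y =>
    pcti_pattern_eq_diagonal hN v i j y
  have hw01 : ∀ y k, w y k = 0 ∨ w y k = 1 := by
    intro y k
    simp only [hw_def]
    split_ifs
    · exact pcti_up01 n k
    · exact pcti_dn01 n k
    · exact Or.inr rfl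
  refine ⟨fun σ => ∏ y, w y (σ y), fun σ => ?_, ?_, fun σ hσ => ?_⟩
  · by_cases h : ∃ y, w y (σ y) = 0
    · obtain ⟨y, hy⟩ := h
      exact Or.inl (prod_eq_zero (mem_univ y) hy)
    · push Not at h
      exact Or.inr (prod_eq_one fun y _ => (hw01 y (σ y)).resolve_left (h y))
  · rw [show (fun y => cubePattern hN v (selectedOp (szNonnegProj n) (szNegProj n) {i} {j})
      (blockOf N b (i - v)) (mirroredOffset hN y)) = fun y => diagonal (w y) from funext hw]
    exact pcti_productOp_diagonal w
  · exact pcti_energy_ge hN hN1 hL hij hblk (pcti_compat_of_ne_zero hN hji hblk w hw hσ)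

end DipolePackage

end Literature.MathematicalPhysics.QuantumLattice

end
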